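import Mathlib
import HarnessLib
import Summits.NavierStokesRegularity.NavierStokesRegularity.Theorems.UnthreadedDoorNetFluxDefs
import Summits.NavierStokesRegularity.NavierStokesRegularity.Theorems.UnthreadedDoorNetFluxSphereSard
import Summits.NavierStokesRegularity.NavierStokesRegularity.Theorems.UnthreadedDoorNetFluxLevelChart
import Summits.NavierStokesRegularity.NavierStokesRegularity.Theorems.UnthreadedDoorNetFluxLevelConstancy
import Summits.NavierStokesRegularity.NavierStokesRegularity.Theorems.UnthreadedDoorNetFluxLevelLipschitz

/-!
# Route `UnthreadedDoor`, crux `PoloidalLiouville` (stmt-NavierStokesRegularity-1222), WALL W1 — netflux / height-head: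
# THE LEVEL-LIPSCHITZ LEMMA FROM LEVEL CONSTANCY ALONE (no unimodality)

In the proof of the landed (Λ) `NetFlux.levelLipschitz` (p673753) the saddle-free hypothesis `IsUnimodalSphere` is used at
exactly ONE place: to know that the head is constant on every level set of `f|_{S_r}` (`eq_of_level`, via the unicoherence of
`S²`).  Everything else — continuity of the value function `H` on the interval `f(S_r)`, local monotonicity at regular values
(`exists_levelChart`), nullity of `H(critical values)` (Sard on the sphere), and the last-crossing lemma — is unimodality-free.
This file records that split, for the lines that restore level constancy on MULTI-HILL spheres by other means (ns-idea-14's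
crux idea «height-head», `Cruxes/PoloidalLiouville/HeightHeadSketch.lean`: analytic rigidity across non-degenerate saddles +
Reeb-tree gluing give `g = G ∘ f` on the whole sphere):

* `le_of_level_le_of_levelConst` — `f, ν` smooth and `h ∈ C¹` off `x₀`, `∇h − ν∇f ∥ (x − x₀)` on `S_r`, `ν ≤ 0` on `S_r`, and
  `h` CONSTANT ON EVERY LEVEL SET of `f|_{S_r}` ⇒ `f y ≤ f x → h x ≤ h y`;
* **`levelLipschitz_of_levelConst`** — the binders of `levelLipschitz` VERBATIM with `IsUnimodalSphere f x₀ r` REPLACED by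
  `∀ x ∈ S_r, ∀ y ∈ S_r, f x = f y → g x = g y` ⇒ the same slice inequality `|g x − g y| ≤ L |f x − f y|`.
  (`levelLipschitz` = this ∘ `eq_of_level`; K1b `ReebTreeGluing` of the height-head sketch = (Reeb-tree level constancy) ∘ this.)

WHAT THIS IS NOT: no NS statement; `PoloidalLiouville` (1222), W1 and every height-head Prop stay OPEN here.
`--supports stmt-NavierStokesRegularity-1222 --as helper`.  [folklore]
-/

noncomputable section

-- the summit and its single sub-problem share the name (CONVENTIONS §1)
set_option linter.dupNamespace false

open Set Function Filter Topology InnerProductSpace MeasureTheory Metric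
open scoped RealInnerProductSpace ContDiff

namespace Summit.NavierStokesRegularity.NavierStokesRegularity.Theorems.PoloidalLiouville.NetFlux

open Literature.Analysis Literature.Analysis.FluidPDE

section OneSided

variable {f h ν : E3 → ℝ} {x₀ : E3} {r : ℝ}

/-- **`h` is a non-increasing function of the values of `f` — from LEVEL CONSTANCY of `h`, no unimodality** (one-sided
level-Lipschitz lemma; hypotheses in the module docstring). [folklore] -/
theorem le_of_level_le_of_levelConst (hr : 0 < r) (hf : ContDiffOn ℝ (⊤ : ℕ∞) f ({x₀}ᶜ : Set E3))
    (hν : ContDiffOn ℝ (⊤ : ℕ∞) ν ({x₀}ᶜ : Set E3)) (hh : ContDiffOn ℝ 1 h ({x₀}ᶜ : Set E3))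
    (hpar : ∀ x ∈ Metric.sphere x₀ r, cross (gradient h x - ν x • gradient f x) (x - x₀) = 0)
    (hνle : ∀ x ∈ Metric.sphere x₀ r, ν x ≤ 0)
    (hlevel : ∀ z ∈ Metric.sphere x₀ r, ∀ w ∈ Metric.sphere x₀ r, f z = f w → h z = h w)
    {x y : E3} (hx : x ∈ Metric.sphere x₀ r) (hy : y ∈ Metric.sphere x₀ r) (hle : f y ≤ f x) : h x ≤ h y := by
  classical
  set S : Set E3 := Metric.sphere x₀ r with hS
  have hsub : S ⊆ ({x₀}ᶜ : Set E3) := fun z hz h0 => by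
    rw [mem_singleton_iff] at h0
    have := mem_sphere_iff_norm.1 hz
    rw [h0, sub_self, norm_zero] at this
    exact hr.ne' this.symm
  have hfS : ContinuousOn f S := hf.continuousOn.mono hsub
  have hhS : ContinuousOn h S := hh.continuousOn.mono hsub
  have hf1 : ContDiffOn ℝ 1 f ({x₀}ᶜ : Set E3) := hf.of_le (by exact_mod_cast le_top)
  -- `H`, the function of the values: `H (f z) = h z` on `S`
  set xsel : ℝ → E3 := invFunOn f S with hxsel
  have hxsel : ∀ c ∈ f '' S, xsel c ∈ S ∧ f (xsel c) = c := fun c hc => invFunOn_pos hc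
  set H : ℝ → ℝ := fun c => h (xsel c) with hH
  have hHf : ∀ z ∈ S, H (f z) = h z := by
    intro z hz
    obtain ⟨h1, h2⟩ := hxsel (f z) (mem_image_of_mem f hz)
    exact hlevel _ h1 _ hz h2
  -- the interval of values
  have hIcc : Icc (f y) (f x) ⊆ f '' S :=
    ((isPreconnected_sphere_E3 x₀ r).image f hfS).Icc_subset (mem_image_of_mem f hy) (mem_image_of_mem f hx)
  -- `H` is continuous on `f(S)`
  have hHc : ContinuousOn H (f '' S) := by
    rw [continuousOn_iff_isClosed]
    intro t ht
    have hK : IsClosed (S ∩ h ⁻¹' t) := hhS.preimage_isClosed_of_isClosed isClosed_sphere ht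
    have hKc : IsCompact (S ∩ h ⁻¹' t) := (isCompact_sphere x₀ r).of_isClosed_subset hK inter_subset_left
    refine ⟨f '' (S ∩ h ⁻¹' t), (hKc.image_of_continuousOn (hfS.mono inter_subset_left)).isClosed, ?_⟩
    ext c
    constructor
    · rintro ⟨hct, hcS⟩
      obtain ⟨h1, h2⟩ := hxsel c hcS
      exact ⟨⟨xsel c, ⟨h1, hct⟩, h2⟩, hcS⟩
    · rintro ⟨⟨w, ⟨hwS, hwt⟩, rfl⟩, hcS⟩
      refine ⟨?_, hcS⟩
      show H (f w) ∈ t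
      rw [hHf w hwS]; exact hwt
  -- critical values
  set C : Set ℝ := f '' {z : E3 | z ∈ Metric.sphere x₀ r ∧ cross (gradient f z) (z - x₀) = 0} with hC
  have hnull : volume (H '' (C ∩ Icc (f y) (f x))) = 0 := by
    refine measure_mono_null ?_ (volume_image_sphCrit_of_parallel_eq_zero f h ν x₀ hr hf hν hh hpar)
    rintro _ ⟨c, ⟨⟨z, hz, rfl⟩, -⟩, rfl⟩
    exact ⟨z, hz, (hHf z hz.1).symm⟩
  -- local monotonicity at regular values
  have hdec : ∀ c ∈ Ico (f y) (f x), c ∉ C → ∃ δ > 0, ∀ c' ∈ Ioo c (c + δ), H c' ≤ H c := by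
    intro c hc hcC
    obtain ⟨hzS, hzc⟩ := hxsel c (hIcc (Ico_subset_Icc_self hc))
    set z := xsel c with hz
    have hreg : cross (gradient f z) (z - x₀) ≠ 0 := fun h0 => hcC ⟨z, ⟨hzS, h0⟩, hzc⟩
    obtain ⟨W, _, hzW, ε, hε, G, hG, hG'⟩ := exists_levelChart hr hf1 hh hpar hzS hreg
    -- `G` is antitone on `(f z - ε, f z + ε)`
    have hGd : ∀ c' ∈ Ioo (f z - ε) (f z + ε), ∃ x' ∈ Metric.sphere x₀ r, HasDerivAt G (ν x') c' := by
      intro c' hc'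
      obtain ⟨x', -, hx'S, -, hd⟩ := hG' c' hc'
      exact ⟨x', hx'S, hd⟩
    have hGanti : AntitoneOn G (Ioo (f z - ε) (f z + ε)) := by
      refine antitoneOn_of_deriv_nonpos (convex_Ioo _ _) ?_ ?_ ?_
      · intro c' hc'
        obtain ⟨x', -, hd⟩ := hGd c' hc'
        exact hd.continuousAt.continuousWithinAt
      · rw [interior_Ioo]
        intro c' hc'
        obtain ⟨x', -, hd⟩ := hGd c' hc'
        exact hd.differentiableAt.differentiableWithinAt
      · rw [interior_Ioo]
        intro c' hc'
        obtain ⟨x', hx'S, hd⟩ := hGd c' hc'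
        rw [hd.deriv]; exact hνle x' hx'S
    refine ⟨ε, hε, fun c' hc' => ?_⟩
    have hc'I : c' ∈ Ioo (f z - ε) (f z + ε) := by
      rw [hzc]; exact ⟨by linarith [hc'.1], hc'.2⟩
    have hcI : c ∈ Ioo (f z - ε) (f z + ε) := by rw [hzc]; exact ⟨by linarith, by linarith⟩
    obtain ⟨x', hx'W, hx'S, hfx', -⟩ := hG' c' hc'I
    have h1 : H c' = G c' := by rw [← hfx', hHf x' hx'S, ((hG x' hx'W hx'S).2)]
    have h2 : H c = G c := by rw [← hzc, hHf z hzS, ((hG z hzW hzS).2)]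
    rw [h1, h2]
    exact hGanti hcI hc'I hc'.1.le
  -- the last-crossing lemma
  have key := lastCrossing_le H hle C (hHc.mono hIcc) hdec hnull
  rwa [hHf x hx, hHf y hy] at key

end OneSided

/-! ### (Λ) from level constancy -/

/-- **(Λ) FROM LEVEL CONSTANCY** — on ANY sphere `S_r(x₀)` (`r > 0`), a `C¹` function `g` whose tangential gradient is `μ`
times that of the smooth `f` (`∇g − μ∇f ∥ x − x₀` on `S`), with `μ` smooth, `|μ| ≤ L` on `S`, and `g` CONSTANT ON EVERY LEVEL
SET of `f|_S`, is `L`-Lipschitz as a function of the values of `f`: `|g x − g y| ≤ L |f x − f y|` for all `x, y ∈ S`.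
Binders = those of `levelLipschitz` verbatim with `IsUnimodalSphere f x₀ r` replaced by level constancy of `g`. [folklore] -/
theorem levelLipschitz_of_levelConst : ∀ (f g μ : E3 → ℝ) (x₀ : E3) (r L : ℝ), 0 < r →
    ContDiffOn ℝ (⊤ : ℕ∞) f ({x₀}ᶜ : Set E3) → ContDiffOn ℝ 1 g ({x₀}ᶜ : Set E3) →
    ContDiffOn ℝ (⊤ : ℕ∞) μ ({x₀}ᶜ : Set E3) →
    (∀ x ∈ Metric.sphere x₀ r, cross (gradient g x - μ x • gradient f x) (x - x₀) = 0) →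
    (∀ x ∈ Metric.sphere x₀ r, |μ x| ≤ L) →
    (∀ x ∈ Metric.sphere x₀ r, ∀ y ∈ Metric.sphere x₀ r, f x = f y → g x = g y) →
    ∀ x ∈ Metric.sphere x₀ r, ∀ y ∈ Metric.sphere x₀ r, |g x - g y| ≤ L * |f x - f y| := by
  intro f g μ x₀ r L hr hf hg hμ hpar hL hconst
  have hf1 : ContDiffOn ℝ 1 f ({x₀}ᶜ : Set E3) := hf.of_le (by exact_mod_cast le_top)
  have hne : ∀ x ∈ Metric.sphere x₀ r, x ≠ x₀ := fun x hx h0 => by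
    have := mem_sphere_iff_norm.1 hx
    rw [h0, sub_self, norm_zero] at this
    exact hr.ne' this.symm
  -- the two auxiliary functions `h± = ±g − L f`, `ν± = ±μ − L ≤ 0`
  have hh : ∀ s : ℝ, ContDiffOn ℝ 1 (fun x => s * g x + (-L) * f x) ({x₀}ᶜ : Set E3) := fun s =>
    (contDiffOn_const.mul hg).add (contDiffOn_const.mul hf1)
  have hν : ∀ s : ℝ, ContDiffOn ℝ (⊤ : ℕ∞) (fun x => s * μ x + (-L)) ({x₀}ᶜ : Set E3) := fun s =>
    (contDiffOn_const.mul hμ).add contDiffOn_const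
  have hpar' : ∀ s : ℝ, ∀ x ∈ Metric.sphere x₀ r,
      cross (gradient (fun x => s * g x + (-L) * f x) x - (s * μ x + (-L)) • gradient f x) (x - x₀) = 0 := by
    intro s x hx
    rw [gradient_lincomb hf1 hg s (-L) (hne x hx)]
    have e : s • gradient g x + (-L) • gradient f x - (s * μ x + -L) • gradient f x =
        s • (gradient g x - μ x • gradient f x) := by
      rw [add_smul, mul_smul, smul_sub]; abel
    rw [e, Tao2016.cross_smul_left, hpar x hx, smul_zero]
  have hνle : ∀ s : ℝ, (s = 1 ∨ s = -1) → ∀ x ∈ Metric.sphere x₀ r, s * μ x + (-L) ≤ 0 := by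
    intro s hs x hx
    have h := hL x hx
    rw [abs_le] at h
    rcases hs with rfl | rfl <;> linarith [h.1, h.2]
  have hlev : ∀ s : ℝ, ∀ z ∈ Metric.sphere x₀ r, ∀ w ∈ Metric.sphere x₀ r, f z = f w →
      s * g z + (-L) * f z = s * g w + (-L) * f w := fun s z hz w hw hzw => by rw [hconst z hz w hw hzw, hzw]
  have mono : ∀ s : ℝ, (s = 1 ∨ s = -1) → ∀ x ∈ Metric.sphere x₀ r, ∀ y ∈ Metric.sphere x₀ r, f y ≤ f x →
      s * g x + (-L) * f x ≤ s * g y + (-L) * f y :=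
    fun s hs x hx y hy hle => le_of_level_le_of_levelConst hr hf (hν s) (hh s) (hpar' s) (hνle s hs) (hlev s) hx hy hle
  intro x hx y hy
  rcases le_total (f y) (f x) with hle | hle
  · rw [abs_of_nonneg (sub_nonneg.2 hle), abs_le]
    have h1 := mono 1 (Or.inl rfl) x hx y hy hle
    have h2 := mono (-1) (Or.inr rfl) x hx y hy hle
    constructor <;> linarith
  · rw [abs_of_nonpos (sub_nonpos.2 hle), abs_le]
    have h1 := mono 1 (Or.inl rfl) y hy x hx hle
    have h2 := mono (-1) (Or.inr rfl) y hy x hx hle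
    constructor <;> linarith

end Summit.NavierStokesRegularity.NavierStokesRegularity.Theorems.PoloidalLiouville.NetFlux

end
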